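import Literature.MathematicalPhysics.QuantumFieldTheory.Balaban1983to89.B9Eq342MajorantReadingSeam
import Literature.MathematicalPhysics.QuantumFieldTheory.Balaban1983to89.B9Eq341TowerBlockGeometry

/-!
# `Balaban1983to89.B9Eq349TowerSiteRowSeam` — T. Bałaban, *Propagators for lattice gauge theories in a background field*, Commun. Math. Phys. **99** (1985) 389–434
# [Balaban1985BackgroundPropagators] Thm 3.2 (3.48) p. 398 ∕ (3.49) p. 399 («y, y′ ∈ 𝔅») and Thm 3.1 (3.42) p. 397, with [Balaban1984PropagatorsII] (2.51) p. 232, (2.46) p. 231: **THE SEAM FOR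
# OPERATORS OF THE COARSE (UNIT) LATTICE WHOSE ROWS DECAY IN THE SUP DISTANCE** — an endomorphism `T` of the chain's coarse carrier `SiteL2K ℂ d m c₁ W` with the SITE row
# `‖(Tg)(x)‖_W ≤ C·e^{−ρ·d_∞(x, v)}·sup‖g‖` for `g` supported at the site `v` (the shape of leaf-03's `B9Eq349ConjugatedQGGQInvSupRowTower.local_letter_QGGQInvk` for the inverse third operator
# `c_k(U)`, and of `B9Eq349QGGQInvSupRow`) HAS, read in `𝔸` and realified, the block majorant `M₂(Σ‖b_i‖)M_φM_φ′·C·e^{−(ρ∕d)·d₁}` over this lineage's one-scale `ℓ¹` geometry `towerGeom`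
# (blocks = sites, block map `(y, i) ↦ y`) — `d₁ ≤ d·d_∞` (`B9Eq341TowerBlockGeometry.tdist1_le_card_mul_tdist`); this is the input shape of `B9Eq367TowerQGGQInvLadder.exists_hasMajorant_QGGQInv_sub_flat`

statement-level skeleton of published theorems with citation tags; proofs where landed; nothing here is a claim about the Yang–Mills mass gap

CITATION HEADER (lean-in-tree rule).  Audit cell `pub-balaban`, sub-cell `t4`, BINDER row NE9; NE9 crux-team LEAF PROVER 01 (`b2b-balaban-t4-ne9-formalise-leaf-01`,
gen 99; bears_on: R4/N22).  Vocabulary BY NAME: this lineage's `B9Eq342MajorantReadingSeam.hasMajorant_conj_readA_of_blockRowW`, `B9Eq341TowerBlockGeometry.towerGeom` ∕ `tdist1_le_card_mul_tdist`,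
`B9Eq324PenaltyKernelForm.readA`, r06's `B9Eq352DivFormLetters.conj`, pv08's `B6RandomWalk.HasMajorant` ∕ `hasMajorant_mono`, `B9Thm34Ext.toB6`, `B4Sect5Torus.tdist`.  Sources read through those
files' verbatim quotations: [Balaban1985BackgroundPropagators] pp. 397–399; [Balaban1984PropagatorsII] pp. 231–232.  [folklore] monotonicity of `exp`; COMPOSITION BY NAME; NOTHING of
print's proofs is reproduced.

WHAT IS PROVED (sorry-free; proof lane — no `def`).
* **`hasMajorant_conj_readA_of_siteRow_tdist`** — site rows in `d_∞` with constant `C` and rate `ρ` ⟹ `conj b (readA φ T) ≺ (M₂(Σ‖b_i‖)M_φM_φ′C)·e^{−(ρ∕d)·d(a,a′)}` over `toB6 (towerGeom …) R_r H`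
  with the block map `(y, i) ↦ y`, for every `n, η, M, R_r, H` (the geometry's fine data are immaterial on the coarse carrier).
HONEST SCOPE.  Bookkeeping; the row is a hypothesis (inhabitants: leaf-03's Combes–Thomas rows with displayed letters); NE9 NOT PRINTED ∕ NOT PROVED; spine PROVED 0∕9; rung (B)+1 finite
T⁴ — NOT infinite volume, NOT mass gap, NOT BetaPertH, NOT Clay.  HONEST DEPENDENCY: continuum YM on T⁴ ⇐ BetaPertH ∧ nine spine estimates (0/9 proved); BetaPertH ⇐ (D1) ∧ (D4) ∧
CAP+tail; G-an2-4 gates asym, D1 and NE2/3/4.  NEW file; nothing modified.  Net new unproved facts: 0.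
-/

noncomputable section

open scoped BigOperators

namespace Literature.MathematicalPhysics.QuantumFieldTheory.Balaban1983to89.B9Eq349TowerSiteRowSeam

open B4Sect5Torus (TSite tdist)
open B9Eq311L2Pairing (WL2)
open B11Eq103H1Complex (SiteL2K)
open B6RandomWalk (HasMajorant hasMajorant_mono)
open B9Thm34Ext (toB6)
open B9Eq352DivFormLetters (conj)
open B9Eq324PenaltyKernelForm (readA)
open B9Eq341TowerBlockGeometry (towerGeom tdist1_le_card_mul_tdist)
open B9Eq342MajorantReadingSeam (hasMajorant_conj_readA_of_blockRowW)

variable {d : ℕ} (L : ℕ) (m : Fin d → ℕ) [∀ i, NeZero (m i)] (n : ℕ) (η M Rr : ℝ) (H : Prop)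
  {𝔸 : Type*} [NormedRing 𝔸] [NormedAlgebra ℂ 𝔸] {W : Type*} [NormedAddCommGroup W] [InnerProductSpace ℂ W]
  (φ : W ≃ₗ[ℂ] 𝔸) {c₁ : ℝ} {Mφ Mφ' : ℝ} (hMφ : 0 ≤ Mφ) (hMφ' : 0 ≤ Mφ') (hφn : ∀ w, ‖φ w‖ ≤ Mφ * ‖w‖) (hφn' : ∀ X, ‖φ.symm X‖ ≤ Mφ' * ‖X‖)
  {ι : Type} [Fintype ι] (b : Module.Basis ι ℝ 𝔸) {M₂ : ℝ} (hM₂ : 0 ≤ M₂) (hrepr : ∀ (v : 𝔸) (i : ι), |b.repr v i| ≤ M₂ * ‖v‖)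

include hMφ hMφ' hφn hφn' hM₂ hrepr in
/-- **SITE ROWS IN THE SUP DISTANCE ⟹ A BLOCK MAJORANT OVER `towerGeom`** (blocks = sites on the coarse lattice): if `‖(Tg)(x)‖ ≤ C·e^{−ρ·d_∞(x,v)}·F` for every `g` vanishing off the site `v`
with `‖g(y)‖ ≤ F`, then `conj b (readA φ T) ≺ (M₂(Σ_i‖b_i‖)·M_φM_φ′·C)·e^{−(ρ∕d)·d₁(a,a′)}` (`d ≥ 1`, `ρ ≥ 0`; `d₁ ≤ d·d_∞`).
[cite: Balaban1985BackgroundPropagators, Thm 3.2 (3.48) p.398, (3.49) p.399, Thm 3.1 (3.42) p.397; Balaban1984PropagatorsII, (2.51) p.232, (2.46) p.231] -/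
theorem hasMajorant_conj_readA_of_siteRow_tdist (hd : 1 ≤ d) (T : SiteL2K ℂ d m c₁ W →ₗ[ℂ] SiteL2K ℂ d m c₁ W) {C ρ : ℝ} (hC : 0 ≤ C) (hρ : 0 ≤ ρ)
    (hT : ∀ (v : TSite d m) (g : SiteL2K ℂ d m c₁ W) (F : ℝ), (∀ x, x ≠ v → WL2.equiv ℂ (fun _ : TSite d m => c₁) W g x = 0) →
      (∀ y, ‖WL2.equiv ℂ (fun _ : TSite d m => c₁) W g y‖ ≤ F) →
      ∀ x, ‖WL2.equiv ℂ (fun _ : TSite d m => c₁) W (T g) x‖ ≤ C * Real.exp (-(ρ * tdist m x v)) * F) :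
    HasMajorant (g := toB6 (towerGeom L m n η M) Rr H) (fun q : TSite d m × ι => q.1) (conj b (readA φ T))
      (fun a a' => M₂ * (∑ i, ‖b i‖) * (Mφ * Mφ') * C * Real.exp (-(ρ / d * (towerGeom L m n η M).dist a a'))) := by
  have hdpos : (0 : ℝ) < d := by exact_mod_cast hd
  -- the row in the `ℓ¹` distance of `towerGeom`
  have hT' : ∀ (v : TSite d m) (g : SiteL2K ℂ d m c₁ W) (F : ℝ), (∀ x, (fun y : TSite d m => y) x ≠ v → WL2.equiv ℂ (fun _ : TSite d m => c₁) W g x = 0) →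
      (∀ y, ‖WL2.equiv ℂ (fun _ : TSite d m => c₁) W g y‖ ≤ F) →
      ∀ x, ‖WL2.equiv ℂ (fun _ : TSite d m => c₁) W (T g) x‖ ≤
        (fun a a' => C * Real.exp (-(ρ / d * (towerGeom L m n η M).dist a a'))) ((fun y : TSite d m => y) x) v * F := by
    intro v g F hoff hbd x
    have hF : 0 ≤ F := (norm_nonneg _).trans (hbd x)
    refine (hT v g F hoff hbd x).trans (mul_le_mul_of_nonneg_right (mul_le_mul_of_nonneg_left (Real.exp_le_exp.mpr ?_) hC) hF)
    show -(ρ * tdist m x v) ≤ -(ρ / d * B9Thm37GlueTorus.tdist1 m x v)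
    have h1 := tdist1_le_card_mul_tdist (m := m) x v
    have h2 : ρ / d * B9Thm37GlueTorus.tdist1 m x v ≤ ρ * tdist m x v := by
      calc ρ / d * B9Thm37GlueTorus.tdist1 m x v ≤ ρ / d * (d * tdist m x v) := mul_le_mul_of_nonneg_left h1 (div_nonneg hρ hdpos.le)
        _ = ρ * tdist m x v := by field_simp
    linarith
  have h := hasMajorant_conj_readA_of_blockRowW φ hMφ hMφ' hφn hφn' b hM₂ hrepr (G := toB6 (towerGeom L m n η M) Rr H) (fun y : TSite d m => y) T _ hT'
  refine hasMajorant_mono _ h fun a a' => le_of_eq ?_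
  show M₂ * (∑ i, ‖b i‖) * (Mφ * Mφ' * (C * Real.exp (-(ρ / d * (towerGeom L m n η M).dist a a')))) = _
  ring

end Literature.MathematicalPhysics.QuantumFieldTheory.Balaban1983to89.B9Eq349TowerSiteRowSeam

end
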